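import Summits.ABC.IUTFork.Repair.CandInternal11
import Summits.ABC.IUTFork.Cor312PilotKummerNaturalWitness
import HarnessLib

/-!
# IUT REPAIR BRANCH (rung LADDER-ABC:A2.RP), class (i) INTERNAL, sub-cell B0, seat rp-d2 — `CandInternal2Nat`: the P♮ CELLS of the log-shell
# rows RP-I05 / I05c / I06 / I06b / I06c / I06d (REPAIR-SPEC v0.4 §PROFILE, RULINGS #11: «every level-H/S row gets a P♮ cell»)

Proof-only file (D-0012) of the abc-iut cell, IUT REPAIR branch (seat abc-iut-rp-d2). TAKES NO SIDE on [IUTchIII] Cor. 3.12 or on any author;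
candidates stay hypotheses; typed ≠ proved; no definition, no `Prop` fact; standard axioms. P♮ = abc-iut-w5-d230's NATURAL (non-identified)
model `NaturalWitness.natSetting` over `natFull` with operator `segRegion` and q-datum `qDatumNat` (Cor312PilotKummerNaturalModel /
…Thm311 / …Witness): typed Thm. 3.11, pins, S = `PilotKummerIndRelated` through a GENUINE (Ind2)-move, hull clause and Statement (strict) hold.

THE CAUSE FIRST (kernel, `natData_act`): in P♮ the [multiplicative] action of Thm. 3.11 (i) (b) — the frozen field `MRData.act` through which
`CandInternal2.shellSat` («X · 𝓘») saturates a datum by the typed log-shell — is the ZERO MAP (model data `natData.act := 0`, documented by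
its author «no action needed: 0»). Consequently every log-shell saturation in P♮ is the zero tuple (`shellSat_nat_subset_zero`) and its
`segRegion` is `{0}` (`segRegion_shellSat_subset_zero`). The cells below therefore record how the rows READ THE ACTION FIELD, not an
arithmetic comparison with S; they are filed because the rule asks for them, with the cause named (no «stronger than S» reading is implied
by a model whose action is zero).

CELLS at P♮ (`natFull`, `natSetting`, `segRegion`, `qDatumNat`): RP-I05 `HInd3Hull` HOLDS (`hInd3Hull_nat`: `{0} ⊆ ⁿ˒°𝒰`); RP-I05c `CandInternal11.H`
FAILS (`not_h11_nat`: the hull `ball` is not inside `{0}`); RP-I06 `HQShellOrbit`, RP-I06b `HQShellOrbitData`, RP-I06c `CandInternal5.H` FAIL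
(`not_hQShellOrbit_nat`, `not_hQShellOrbitData_nat`, `not_h5_nat`: the q-region `halfNeg ∋ −1` is not inside `{0}` / its hull `{0}`); RP-I06d:
q-side half `HQInShell` HOLDS (`hQInShell_nat`), inflation half holds ON `𝔽_l^⋇` (`hShellInHull_nat_labelSucc`: `ball ⊆ ball`; the all-labels
form is not evaluated at the conventional zero label). Packaged with P♮'s own facts (S, hull clause, Statement hold) as `nat_cells`.
[claim: Mochizuki2012, status: disputed]
-/

noncomputable section

open Set

namespace Summit.ABC.IUTFork.Repair.CandInternal2Nat

open Thm311 Cor312 Cor312Vol Literature.IUT.LogThetaLattice Summit.ABC.IUTFork.Repair.CandInternal2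
  Cor312.Checks Cor312.IdentifiedNonVacuity Cor312Vol.NaiveWitness Cor312Vol.PinnedWitness Cor312Vol.NaturalWitness

/-- **THE CAUSE: in P♮ the action (i)(b) `MRData.act` is the zero map** (model data). [folklore] -/
theorem natData_act (n : ℤ) (v : toyIndex.V) (hv : v ∈ toyIndex.Vbad) (ψ ι : signShells.StarPacket v) :
    (natFull.toLatticeSituation.D n).act v hv ψ ι = 0 := rfl

/-- Hence every log-shell saturation «X · 𝓘» in P♮ is contained in the zero tuple. [folklore] -/
theorem shellSat_nat_subset_zero (n : ℤ) (X : ∀ v : toyIndex.V, v ∈ toyIndex.Vbad → Set (signShells.StarPacket v))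
    (v : toyIndex.V) (hv : v ∈ toyIndex.Vbad) : shellSat natFull.toLatticeSituation n X v hv ⊆ {0} := by
  rintro y ⟨ψ, -, ι, -, rfl⟩
  exact Set.mem_singleton_iff.2 (natData_act n v hv ψ ι)

/-- … and its segment region at a label of `𝔽_l^⋇` is contained in `{0}` (at the zero label it is `{0}` by definition). [folklore] -/
theorem segRegion_shellSat_subset_zero (n : ℤ) (X : ∀ v : toyIndex.V, v ∈ toyIndex.Vbad → Set (signShells.StarPacket v))
    (j : toyIndex.Label) (vQ : toyIndex.VQ) : segRegion (shellSat natFull.toLatticeSituation n X) j vQ ⊆ {0} := by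
  by_cases hj : j = 0
  · subst hj; rw [segRegion_zero]
  · intro x hx
    unfold segRegion at hx
    rw [dif_neg hj] at hx
    obtain ⟨ψ, hψ, t, -, -, rfl⟩ := hx
    have h0 : ψ = 0 := Set.mem_singleton_iff.1 (shellSat_nat_subset_zero n X vQ _ hψ)
    rw [h0]
    show t • (0 : signShells.Packet j vQ) ∈ ({0} : Set (signShells.Packet j vQ))
    rw [smul_zero]
    rfl

/-- The union over `m` of these regions is contained in `{0}`. [folklore] -/
theorem iUnion_segRegion_shellSat_subset_zero (j : toyIndex.Label) (vQ : toyIndex.VQ) :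
    (⋃ m : ℤ, segRegion (shellSat natFull.toLatticeSituation natSetting.n ((natFull.toLatticeSituation.col natSetting.n).frobΨ m)) j vQ) ⊆
      {0} :=
  Set.iUnion_subset fun _ => segRegion_shellSat_subset_zero _ _ j vQ

/-- `0` lies in every hull of P♮ (every hull-set of `natFrame` contains `0`). [folklore] -/
theorem zero_mem_thetaHull_nat (j : toyIndex.Label) (vQ : toyIndex.VQ) : (0 : signShells.Packet j vQ) ∈ natSetting.thetaHull j vQ :=
  zero_mem_of_mem_natHul ((natFrame j vQ).hull_mem_of_hasHull (natSetting_hullDefined j vQ).1 (natSetting_hullDefined j vQ).2)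

/-- The point of line-coordinate `−1` is not `0`. [folklore] -/
theorem lpt_neg_one_ne_zero (j : toyIndex.Label) (vQ : toyIndex.VQ) : lpt j vQ (-1) ≠ 0 := fun h => by
  have := congrArg (line j vQ) h
  rw [line_lpt, map_zero] at this
  norm_num at this

/-! ## The cells -/

/-- **P♮ cell, RP-I05: `HInd3Hull` HOLDS** (the saturated orbit is `{0} ⊆ ⁿ˒°𝒰`). [folklore] -/
theorem hInd3Hull_nat : HInd3Hull natFull.toLatticeSituation natSetting segRegion := fun m j vQ x hx => by
  have h0 := segRegion_shellSat_subset_zero _ _ j vQ hx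
  rw [Set.mem_singleton_iff] at h0
  rw [h0]; exact zero_mem_thetaHull_nat j vQ

/-- **P♮ cell, RP-I05c (`CandInternal11.H`, the container bound): FAILS** — the hull `ball` at label `1` is not inside `{0}`. [folklore] -/
theorem not_h11_nat : ¬ CandInternal11.H natFull.toLatticeSituation natSetting segRegion := fun h => by
  have h1 := h (Setting.labelSucc ⟨0, by decide⟩) ()
  rw [natSetting_thetaHull (Setting.labelSucc_ne_zero _)] at h1
  exact lpt_neg_one_ne_zero _ () (Set.mem_singleton_iff.1
    (iUnion_segRegion_shellSat_subset_zero _ () (h1 (lpt_neg_one_mem _ ()).2.1)))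

/-- **P♮ cell, RP-I06: `HQShellOrbit` FAILS** — the q-region `halfNeg ∋ −1` is not inside `{0}`. [folklore] -/
theorem not_hQShellOrbit_nat : ¬ HQShellOrbit natFull.toLatticeSituation natSetting segRegion qDatumNat := fun h => by
  have h1 := h (Setting.labelSucc ⟨0, by decide⟩) ()
  rw [segRegion_qDatumNat (Setting.labelSucc_ne_zero _)] at h1
  exact lpt_neg_one_ne_zero _ () (Set.mem_singleton_iff.1
    (iUnion_segRegion_shellSat_subset_zero _ () (h1 (lpt_neg_one_mem _ ()).1)))

/-- **P♮ cell, RP-I06c (`CandInternal5.H`): FAILS** — the hull of a subset of `{0}` is `{0}` (a hull-set of `natFrame`). [folklore] -/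
theorem not_h5_nat : ¬ CandInternal5.H natFull.toLatticeSituation natSetting segRegion qDatumNat := fun h => by
  have h1 := h (Setting.labelSucc ⟨0, by decide⟩) ()
  rw [segRegion_qDatumNat (Setting.labelSucc_ne_zero _)] at h1
  have hh : (natSetting.frame (Setting.labelSucc (T := toyIndex) ⟨0, by decide⟩) ()).hull
      (⋃ m : ℤ, segRegion (shellSat natFull.toLatticeSituation natSetting.n
        ((natFull.toLatticeSituation.col natSetting.n).frobΨ m)) (Setting.labelSucc ⟨0, by decide⟩) ()) ⊆ {0} :=
    (natFrame _ ()).hull_subset_of_mem (zero_mem_natHul _ ()) (iUnion_segRegion_shellSat_subset_zero _ ())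
  exact lpt_neg_one_ne_zero _ () (Set.mem_singleton_iff.1 (hh (h1 (lpt_neg_one_mem _ ()).1)))

/-- **P♮ cell, RP-I06b (`HQShellOrbitData`): FAILS** — the q-datum `flipFamily · onePt = −onePt` is not the zero tuple. [folklore] -/
theorem not_hQShellOrbitData_nat : ¬ HQShellOrbitData natFull.toLatticeSituation natSetting qDatumNat := by
  rintro ⟨m, hm⟩
  have hq : signShells.starAut flipFamily () (onePt ()) ∈ qDatumNat () (Set.mem_univ _) := ⟨onePt (), rfl, rfl⟩
  have h0 := Set.mem_singleton_iff.1 (shellSat_nat_subset_zero _ _ () _ (hm () (Set.mem_univ _) hq))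
  have h1 : line 1 () ((signShells.starAut flipFamily () (onePt ())) ⟨1, by decide⟩) =
      line 1 () ((0 : signShells.StarPacket ()) ⟨1, by decide⟩) :=
    congrArg (fun f : signShells.StarPacket () => line 1 () (f ⟨1, by decide⟩)) h0
  have h2 : line 1 () ((signShells.starAut flipFamily () (onePt ())) ⟨1, by decide⟩) = -1 := by
    show line 1 () (flipFamily 1 () (onePt () ⟨1, by decide⟩)) = -1
    rw [flipFamily_apply, map_neg, show onePt () ⟨1, by decide⟩ = lpt 1 () 1 from rfl, line_lpt]
  rw [h2] at h1
  have h3 : line 1 () ((0 : signShells.StarPacket ()) ⟨1, by decide⟩) = 0 := map_zero _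
  rw [h3] at h1
  norm_num at h1

/-- **P♮ cell, RP-I06d q-side half (`HQInShell`): HOLDS** (`halfNeg ⊆ ball`, `{0} ⊆ ball`). [folklore] -/
theorem hQInShell_nat : CandInternal8.HQInShell natFull.toLatticeSituation natSetting segRegion qDatumNat := by
  intro j vQ
  show segRegion qDatumNat j vQ ⊆ ball j vQ
  by_cases hj : j = 0
  · subst hj; rw [segRegion_zero]; exact Set.singleton_subset_iff.2 (zero_mem_ball _ vQ)
  · rw [segRegion_qDatumNat hj]; exact halfNeg_subset_ball j vQ

/-- **P♮ cell, RP-I06d inflation half ON `𝔽_l^⋇`: HOLDS** (`ball ⊆ ball`; the zero label is conventional and not read by Cor. 3.12). [folklore] -/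
theorem hShellInHull_nat_labelSucc (i : Fin toyIndex.lstar) (vQ : toyIndex.VQ) :
    (natFull.toLatticeSituation.D natSetting.n).shellPk (Setting.labelSucc i) vQ ⊆ natSetting.thetaHull (Setting.labelSucc i) vQ := by
  rw [natSetting_thetaHull (Setting.labelSucc_ne_zero _)]
  exact subset_rfl

/-- **P♮ CELLS, packaged** (with P♮'s own facts: typed Thm. 3.11, the three pins, S, the hull clause and the STRICT Statement hold there):
RP-I05 ✓ · RP-I05c ✗ · RP-I06 ✗ · RP-I06b ✗ · RP-I06c ✗ · RP-I06d q-half ✓ / inflation half ✓ on `𝔽_l^⋇` — every ✗ caused by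
`natData.act = 0` (the rows read the action (i)(b); P♮ does not model it). [folklore] -/
theorem nat_cells :
    natFull.Statement ∧ PinnedRegions3 natFull.toLatticeSituation natSetting segRegion qDatumNat ∧
      PilotKummerIndRelated natFull.toLatticeSituation natSetting segRegion qDatumNat ∧
      PilotKummerCompatHull natFull.toLatticeSituation natSetting segRegion qDatumNat ∧ natSetting.Statement ∧
      HInd3Hull natFull.toLatticeSituation natSetting segRegion ∧
      ¬ CandInternal11.H natFull.toLatticeSituation natSetting segRegion ∧
      ¬ HQShellOrbit natFull.toLatticeSituation natSetting segRegion qDatumNat ∧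
      ¬ HQShellOrbitData natFull.toLatticeSituation natSetting qDatumNat ∧
      ¬ CandInternal5.H natFull.toLatticeSituation natSetting segRegion qDatumNat ∧
      CandInternal8.HQInShell natFull.toLatticeSituation natSetting segRegion qDatumNat ∧
      (∀ (i : Fin toyIndex.lstar) (vQ : toyIndex.VQ),
        (natFull.toLatticeSituation.D natSetting.n).shellPk (Setting.labelSucc i) vQ ⊆ natSetting.thetaHull (Setting.labelSucc i) vQ) :=
  ⟨natFull_statement, natSetting_pinnedRegions3, natSetting_pilotKummerIndRelated, natSetting_pilotKummerCompatHull,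
    natSetting_statement_strict.1, hInd3Hull_nat, not_h11_nat, not_hQShellOrbit_nat, not_hQShellOrbitData_nat, not_h5_nat,
    hQInShell_nat, hShellInHull_nat_labelSucc⟩

end Summit.ABC.IUTFork.Repair.CandInternal2Nat

end
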